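import Summits.QuantumFields.GaugeBoot.ZdWordSymmetry
import HarnessLib

/-!
# Link reflections of `ℤ^d` are site reflections followed by a unit translation: Class-B / Class-T states are link-reflection invariant (gauge-boot, `ℤ^d` loop equations, supplement 2)

HONEST FRAMING (cell `pub-gaugeboot`, page 1 of every file): the venture produces certified bounds
on lattice expectations at stated coupling, gauge group, dimension and torus size; NOT a mass gap,
NOT a continuum limit, NOT a string tension; NOT Yang–Mills-summit-bearing (barriers
`FixedCouplingUltralocality`, `PerturbativeInvisibility`).

`ClassBState` (`ClassB.lean`) lists invariance under translations, axis permutations and the SITE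
reflections `x_i ↦ -x_i` (`configSiteReflect`); the LINK reflections `x_i ↦ 1 - x_i`
(`configLinkReflect`, the mirror of the `R_link` blocks) are not a separate axiom because they are
generated: `configLinkReflect i = configSiteReflect i ∘ configShift (-e_i)` (`configLinkReflect_eq`).
Consequences, in the `wordHolonomyZd` vocabulary of `ClassBWords.lean` / `ZdWordSymmetry.lean`:

* `measurePreserving_configShift` (translation invariance as `MeasurePreserving`),
  `measurePreserving_configLinkReflect` (site-reflection + translation invariance ⇒ link-reflection
  invariance); `ClassBState.linkReflectInvariant`, `TiltedRP.TiltedClassState.linkReflectInvariant`;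
* `wordHolonomyZd_configLinkReflect`: `hol_x(w)(Θ^link_i U) = hol_{1-x_i}(flip_i w)(U)`;
* the loop / pair variables are invariant under `(x, w) ↦ (zdLinkReflect i x, flip_i w)` for every
  measure preserved by `configLinkReflect i`, in particular for every Class-B and every Class-T state
  (`ClassBState.integral_trace(_mul_trace)_linkReflect`, `TiltedClassState.…`).

Everything is `[folklore]`.

References: V. Kazakov, Z. Zheng, arXiv:2404.16925 §3.2 (the three mirror families); H.-O. Georgii,
*Gibbs Measures and Phase Transitions* (2011) §5.1.
-/

noncomputable section

open MeasureTheory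
open scoped Matrix
open Literature.Probability.LatticeModels (Site)
open Literature.MathematicalPhysics.QuantumLattice (LGConfig ZdEdge configShift configShift_apply
  IsZdTranslationInvariant)

namespace Summit.QuantumFields.GaugeBoot

variable {d N : ℕ} {G : Type*} [Group G]

/-! ### The link reflection as site reflection plus translation -/

section Algebra

/-- `zdLinkReflect i x = zdSiteReflect i x + e_i` (`1 - x_i = -x_i + 1`). [folklore] -/
theorem zdLinkReflect_eq_zdSiteReflect_add (i : Fin d) (x : Site d) :
    zdLinkReflect i x = zdSiteReflect i x + Pi.single i 1 := by
  ext k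
  by_cases hk : k = i
  · subst hk; simp [zdLinkReflect, zdSiteReflect]; ring
  · simp [zdLinkReflect, zdSiteReflect, hk]

/-- **`configLinkReflect i = configSiteReflect i ∘ configShift (-e_i)`**: the link reflection of
configurations is the site reflection of the configuration translated by `-e_i`. [folklore] -/
theorem configLinkReflect_eq [MeasurableSpace G] (i : Fin d) (U : LGConfig d G) :
    configLinkReflect i U = configSiteReflect i (configShift (-(Pi.single i 1 : Site d)) U) := by
  funext e
  by_cases he : e.2 = i
  · simp only [configLinkReflect, configSiteReflect, he, if_true, configShift_apply, sub_neg_eq_add,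
      zdLinkReflect_eq_zdSiteReflect_add, add_sub_cancel_right, sub_add_cancel]
  · simp only [configLinkReflect, configSiteReflect, he, if_false, configShift_apply, sub_neg_eq_add,
      zdLinkReflect_eq_zdSiteReflect_add]

/-- **Link reflections read words as** `hol_x(w)(Θ^link_i U) = hol_{zdLinkReflect i x}(flip_i w)(U)`.
[folklore] -/
theorem wordHolonomyZd_configLinkReflect [MeasurableSpace G] (i : Fin d) (U : LGConfig d G) (x : Site d)
    (w : Word d) :
    wordHolonomyZd (configLinkReflect i U) x w =
      wordHolonomyZd U (zdLinkReflect i x) (w.map (Step.flipAt i)) := by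
  rw [configLinkReflect_eq, wordHolonomyZd_configSiteReflect, wordHolonomyZd_configShift, sub_neg_eq_add,
    zdLinkReflect_eq_zdSiteReflect_add]

end Algebra

/-! ### Invariance -/

section Invariance

variable [MeasurableSpace G] {μW : Measure (LGConfig d G)}

omit [Group G] in
/-- Translation invariance as `MeasurePreserving`. [folklore] -/
theorem measurePreserving_configShift (hT : IsZdTranslationInvariant μW) (v : Site d) :
    MeasurePreserving (configShift v) μW μW :=
  ⟨(configShift v).measurable, hT v⟩

/-- **Site-reflection invariance and translation invariance imply link-reflection invariance.**
[folklore] -/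
theorem measurePreserving_configLinkReflect (hT : IsZdTranslationInvariant μW) {i : Fin d}
    (hi : MeasurePreserving (configSiteReflect i) μW μW) :
    MeasurePreserving (configLinkReflect i) μW μW := by
  have h : (configLinkReflect i : LGConfig d G → LGConfig d G) =
      configSiteReflect i ∘ configShift (-(Pi.single i 1 : Site d)) :=
    funext fun U => configLinkReflect_eq i U
  rw [h]
  exact hi.comp (measurePreserving_configShift hT _)

variable [TopologicalSpace G] [BorelSpace G] [SecondCountableTopology G] [IsTopologicalGroup G]
  (ρ : G →* Matrix (Fin N) (Fin N) ℂ)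

/-- **Loop and pair variables are invariant under a link reflection preserving the measure**:
`∫ tr ρ(hol_{1-x_i}(flip_i u))·tr ρ(hol_{1-y_i}(flip_i w)) dμ = ∫ tr ρ(hol_x u)·tr ρ(hol_y w) dμ`.
[folklore] -/
theorem integral_trace_mul_trace_wordHolonomyZd_linkReflect (hρ : Continuous ρ) {i : Fin d}
    (hi : MeasurePreserving (configLinkReflect i) μW μW) (x y : Site d) (u w : Word d) :
    ∫ U, (ρ (wordHolonomyZd U (zdLinkReflect i x) (u.map (Step.flipAt i)))).trace *
        (ρ (wordHolonomyZd U (zdLinkReflect i y) (w.map (Step.flipAt i)))).trace ∂μW =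
      ∫ U, (ρ (wordHolonomyZd U x u)).trace * (ρ (wordHolonomyZd U y w)).trace ∂μW := by
  have h := integral_comp_eq_of_measurePreserving hi
    (fun U => (ρ (wordHolonomyZd U x u)).trace * (ρ (wordHolonomyZd U y w)).trace)
    ((continuous_trace_wordHolonomyZd ρ hρ x u).mul (continuous_trace_wordHolonomyZd ρ hρ y w))
  simp only [wordHolonomyZd_configLinkReflect] at h
  exact h

/-- Loop variables are invariant under a link reflection preserving the measure. [folklore] -/
theorem integral_trace_wordHolonomyZd_linkReflect (hρ : Continuous ρ) {i : Fin d}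
    (hi : MeasurePreserving (configLinkReflect i) μW μW) (x : Site d) (w : Word d) :
    ∫ U, (ρ (wordHolonomyZd U (zdLinkReflect i x) (w.map (Step.flipAt i)))).trace ∂μW =
      ∫ U, (ρ (wordHolonomyZd U x w)).trace ∂μW := by
  have h := integral_comp_eq_of_measurePreserving hi (fun U => (ρ (wordHolonomyZd U x w)).trace)
    (continuous_trace_wordHolonomyZd ρ hρ x w)
  simp only [wordHolonomyZd_configLinkReflect] at h
  exact h

end Invariance

/-! ### Class-B and Class-T states -/

section States

variable [TopologicalSpace G] [IsTopologicalGroup G] [MeasurableSpace G] [BorelSpace G]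
  [SecondCountableTopology G] {ρ : G →* Matrix (Fin N) (Fin N) ℂ} {β : ℝ}

omit [IsTopologicalGroup G] [BorelSpace G] [SecondCountableTopology G] in
/-- **Every Class-B state is invariant under the link reflections `x_i ↦ 1 - x_i`** (the mirror of
its `R_link` blocks) — not an extra axiom: site reflections and translations generate them. [folklore] -/
theorem ClassBState.linkReflectInvariant (ω : ClassBState d ρ β) (i : Fin d) :
    MeasurePreserving (configLinkReflect i) ω.μ ω.μ :=
  measurePreserving_configLinkReflect ω.translationInvariant (ω.reflectInvariant i)

omit [IsTopologicalGroup G] [BorelSpace G] [SecondCountableTopology G] in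
/-- Every Class-T state is invariant under the link reflections of every axis. [folklore] -/
theorem TiltedRP.TiltedClassState.linkReflectInvariant {i j : Fin d}
    (ω : TiltedRP.TiltedClassState d i j ρ β) (k : Fin d) :
    MeasurePreserving (configLinkReflect k) ω.μ ω.μ :=
  measurePreserving_configLinkReflect ω.translationInvariant (ω.reflectInvariant k)

/-- Class B: pair and loop variables are invariant under the link reflections. [folklore] -/
theorem ClassBState.integral_trace_mul_trace_linkReflect (hρ : Continuous ρ) (ω : ClassBState d ρ β)
    (i : Fin d) (x y : Site d) (u w : Word d) :
    (∫ U, (ρ (wordHolonomyZd U (zdLinkReflect i x) (u.map (Step.flipAt i)))).trace *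
          (ρ (wordHolonomyZd U (zdLinkReflect i y) (w.map (Step.flipAt i)))).trace ∂ω.μ =
        ∫ U, (ρ (wordHolonomyZd U x u)).trace * (ρ (wordHolonomyZd U y w)).trace ∂ω.μ) ∧
      (∫ U, (ρ (wordHolonomyZd U (zdLinkReflect i x) (u.map (Step.flipAt i)))).trace ∂ω.μ =
        ∫ U, (ρ (wordHolonomyZd U x u)).trace ∂ω.μ) :=
  ⟨integral_trace_mul_trace_wordHolonomyZd_linkReflect ρ hρ (ω.linkReflectInvariant i) x y u w,
    integral_trace_wordHolonomyZd_linkReflect ρ hρ (ω.linkReflectInvariant i) x u⟩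

/-- Class T: pair and loop variables are invariant under the link reflections of every axis.
[folklore] -/
theorem TiltedRP.TiltedClassState.integral_trace_mul_trace_linkReflect (hρ : Continuous ρ) {i j : Fin d}
    (ω : TiltedRP.TiltedClassState d i j ρ β) (k : Fin d) (x y : Site d) (u w : Word d) :
    (∫ U, (ρ (wordHolonomyZd U (zdLinkReflect k x) (u.map (Step.flipAt k)))).trace *
          (ρ (wordHolonomyZd U (zdLinkReflect k y) (w.map (Step.flipAt k)))).trace ∂ω.μ =
        ∫ U, (ρ (wordHolonomyZd U x u)).trace * (ρ (wordHolonomyZd U y w)).trace ∂ω.μ) ∧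
      (∫ U, (ρ (wordHolonomyZd U (zdLinkReflect k x) (u.map (Step.flipAt k)))).trace ∂ω.μ =
        ∫ U, (ρ (wordHolonomyZd U x u)).trace ∂ω.μ) :=
  ⟨integral_trace_mul_trace_wordHolonomyZd_linkReflect ρ hρ (ω.linkReflectInvariant k) x y u w,
    integral_trace_wordHolonomyZd_linkReflect ρ hρ (ω.linkReflectInvariant k) x u⟩

end States

end Summit.QuantumFields.GaugeBoot

end
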